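import Summits.CriticalPhenomena.PercolationContinuityZ3.Theorems.PercNearOneGluingNoHeavyLowerTailFrontierDecRowsUnmarkedEdgePath
import HarnessLib

/-!
# PATH (row 36) and row 44 on every finite weighted graph from ONE resp. TWO families of five-point forms: symmetry reductions of the
# unmarked-edge hypotheses

Support file (prover seat `prim-bnk-1`, gen 8; `--supports stmt-CriticalPhenomena-4575`).  No named facts, no sorries, no `native_decide`; one bookkeeping
definition `UnmarkedEdgeHypAt i₀` (= the unmarked-edge hypotheses `UnmarkedEdgeHyp` of `…FrontierDecRowsUnmarkedEdgeInduction` at the single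
terminal `i₀`).  Sequel of `…FrontierDecRowsUnmarkedEdgePath`.

`UnmarkedEdgeHyp` asks for the polarised forms at every terminal `i : Fin 4`; the symmetry group of a row identifies terminal types:
* `UnmarkedEdgeHypAt.transport`: if an injective relabelling `σ` of the terminals with `σ i₀ = i₁` maps the event triple to itself (possibly with
  the last two slots swapped — `E₃` and `polar₁` are invariant, `sahiE3_comm₂₃`, `polar₁_swap₂₃`), the hypotheses at `i₀` give those at `i₁`;
* row 44 `(D[ab|cy], D[a|b], D[c|y])`: the symmetries `(a b)`, `(a c)(b y)`, `(a y)(b c)` act transitively on the terminals, so the hypotheses at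
  `a` suffice (`unmarkedEdgeHyp_row44_of_at0`) and **`frontier_44_all_of_at0`**: `(∀ m, UnmarkedEdgeHypAt 0 …) → ∀ n w a b c y, 0 ≤ E₃(D[ab|cy], D[a|b], D[c|y])`;
* PATH `(D[a|b], D[a|c], D[b|y])` (path `c – a – b – y`): the reflection `(a b)(c y)` maps hub to hub and leaf to leaf, so the hypotheses at the hub
  `a` and the leaf `c` suffice (`unmarkedEdgeHyp_row36_of_at0_at2`) and **`frontier_36_all_of_at0_at2`**.
So: ROW 44 FOR ALL GRAPHS ⟸ one pair `B₁, B₂ ≥ 0` of cubic inequalities in the 52-cell law of `(a,b,c,y,u)` (edge `a — u`, `u` unmarked, law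
under `w[au ↦ 0]`, induction-hypothesis rows `E₃ ≥ 0` under `w[au↦0], w[au↦1]`); PATH ⟸ two such pairs (edges `a — u` and `c — u`).
-/

noncomputable section

namespace Summit.CriticalPhenomena.PercolationContinuityZ3.Theorems

namespace TerminalEdgeInduction

open MeasureTheory Literature.Probability.Percolation Literature.Probability.LatticeModels
open EdgeInduction CovTransferCert E3GroupSepCert
open scoped Classical

variable {n k : ℕ}
/-! ### Symmetry bookkeeping: `polar₁` under swapping the last two slots (`E₃`: `sahiE3_comm₂₃`); separations under re-listing -/

/-- `polar₁ μ ν A C B = polar₁ μ ν A B C`. [folklore] -/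
theorem polar₁_swap₂₃ (μ ν : Measure (BondConfig (Fin n))) (A B C : Set (BondConfig (Fin n))) :
    polar₁ μ ν A C B = polar₁ μ ν A B C := by
  simp only [polar₁]
  rw [Set.inter_right_comm A C B, Set.inter_comm C B]
  ring

/-- `D[X|Y]` only depends on the vertex sets of the lists `X, Y`. [folklore] -/
theorem connEvent_sep_congr {X X' Y Y' : List (Fin n)} (hX : ∀ v, v ∈ X ↔ v ∈ X') (hY : ∀ v, v ∈ Y ↔ v ∈ Y') :
    connEvent (sep X Y) = connEvent (sep X' Y') := by
  rw [connEvent_sep, connEvent_sep]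
  ext ω
  simp only [Set.mem_setOf_eq]
  constructor
  · intro h x hx y hy; exact h x ((hX x).2 hx) y ((hY y).2 hy)
  · intro h x hx y hy; exact h x ((hX x).1 hx) y ((hY y).1 hy)

/-! ### The unmarked-edge hypotheses at ONE terminal, and the symmetry reductions for PATH (row 36) and row 44 -/

/-- **The unmarked-edge hypotheses at the terminal `i₀` only** (`UnmarkedEdgeHyp` = the conjunction over all terminals `i₀`). [this work] -/
def UnmarkedEdgeHypAt (i₀ : Fin k) (E₁ E₂ E₃ : (Fin k → Fin n) → Set (BondConfig (Fin n))) : Prop :=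
  ∀ (w : Sym2 (Fin n) → unitInterval) (x : Fin k → Fin n), Function.Injective x → ∀ (u : Fin n), (∀ j, x j ≠ u) →
    0 ≤ sahiE3 (prodBernoulli (Function.update w s(x i₀, u) 0)) (E₁ x) (E₂ x) (E₃ x) →
    0 ≤ sahiE3 (prodBernoulli (Function.update w s(x i₀, u) 1)) (E₁ x) (E₂ x) (E₃ x) →
    0 ≤ polar₁ (prodBernoulli (Function.update w s(x i₀, u) 0)) (prodBernoulli (Function.update w s(x i₀, u) 1))
        (E₁ x) (E₂ x) (E₃ x) ∧
    0 ≤ polar₁ (prodBernoulli (Function.update w s(x i₀, u) 1)) (prodBernoulli (Function.update w s(x i₀, u) 0))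
        (E₁ x) (E₂ x) (E₃ x)

variable {E₁ E₂ E₃ : (Fin k → Fin n) → Set (BondConfig (Fin n))}

/-- `UnmarkedEdgeHyp` is the conjunction of the `UnmarkedEdgeHypAt i₀`. [this work] -/
theorem unmarkedEdgeHyp_of_forall_at (h : ∀ i₀, UnmarkedEdgeHypAt i₀ E₁ E₂ E₃) : UnmarkedEdgeHyp E₁ E₂ E₃ :=
  fun w x hx i u hu h0 h1 => h i w x hx u hu h0 h1

/-- **Transport of the hypotheses at one terminal along a relabelling of the terminals.**  If `σ : Fin k → Fin k` is injective with
`σ i₀ = i₁`, and the event triple at the relabelled marking `x ∘ σ` is the triple at `x` with the last two slots possibly swapped, then the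
hypotheses at `i₀` give the hypotheses at `i₁`. [this work] -/
theorem UnmarkedEdgeHypAt.transport {i₀ i₁ : Fin k} (σ : Fin k → Fin k) (hσ : Function.Injective σ) (hσi : σ i₀ = i₁)
    (hE : ∀ (x : Fin k → Fin n), (E₁ (x ∘ σ) = E₁ x ∧ E₂ (x ∘ σ) = E₂ x ∧ E₃ (x ∘ σ) = E₃ x) ∨
      (E₁ (x ∘ σ) = E₁ x ∧ E₂ (x ∘ σ) = E₃ x ∧ E₃ (x ∘ σ) = E₂ x))
    (h : UnmarkedEdgeHypAt i₀ E₁ E₂ E₃) : UnmarkedEdgeHypAt i₁ E₁ E₂ E₃ := by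
  intro w x hx u hu h0 h1
  have hx' : Function.Injective (x ∘ σ) := hx.comp hσ
  have hu' : ∀ j, (x ∘ σ) j ≠ u := fun j => hu (σ j)
  have he : s((x ∘ σ) i₀, u) = s(x i₁, u) := by rw [Function.comp_apply, hσi]
  have H := h w (x ∘ σ) hx' u hu'
  rw [he] at H
  rcases hE x with ⟨e1, e2, e3⟩ | ⟨e1, e2, e3⟩
  · rw [e1, e2, e3] at H
    exact H h0 h1
  · rw [e1, e2, e3, ← sahiE3_comm₂₃ _ (E₁ x) (E₂ x) (E₃ x), ← sahiE3_comm₂₃ _ (E₁ x) (E₂ x) (E₃ x),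
      polar₁_swap₂₃ _ _ (E₁ x) (E₂ x) (E₃ x), polar₁_swap₂₃ _ _ (E₁ x) (E₂ x) (E₃ x)] at H
    exact H h0 h1


/-- **Row 44 `(D[ab|cy], D[a|b], D[c|y])`: the hypotheses at terminal `a` give them at every terminal** (symmetries `a↔b`, `(a c)(b y)`,
`(a y)(b c)` of the triple). [this work] -/
theorem unmarkedEdgeHyp_row44_of_at0 {m : ℕ}
    (h : UnmarkedEdgeHypAt 0 (fun x : Fin 4 → Fin m => connEvent (FrontierDecRows.row 44 m (x 0, x 1, x 2, x 3)).1)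
      (fun x => connEvent (FrontierDecRows.row 44 m (x 0, x 1, x 2, x 3)).2.1)
      (fun x => connEvent (FrontierDecRows.row 44 m (x 0, x 1, x 2, x 3)).2.2)) :
    UnmarkedEdgeHyp (fun x : Fin 4 → Fin m => connEvent (FrontierDecRows.row 44 m (x 0, x 1, x 2, x 3)).1)
      (fun x => connEvent (FrontierDecRows.row 44 m (x 0, x 1, x 2, x 3)).2.1)
      (fun x => connEvent (FrontierDecRows.row 44 m (x 0, x 1, x 2, x 3)).2.2) := by
  refine unmarkedEdgeHyp_of_forall_at fun i₀ => ?_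
  fin_cases i₀
  · exact h
  · -- b: relabel by the transposition (a b)
    refine h.transport ![1, 0, 2, 3] (by decide) rfl fun x => Or.inl ?_
    show connEvent (sep [x 1, x 0] [x 2, x 3]) = connEvent (sep [x 0, x 1] [x 2, x 3]) ∧
      connEvent (sep [x 1] [x 0]) = connEvent (sep [x 0] [x 1]) ∧ connEvent (sep [x 2] [x 3]) = connEvent (sep [x 2] [x 3])
    exact ⟨connEvent_sep_congr (by simp [or_comm]) (by simp), connEvent_sep_comm _ _, rfl⟩
  · -- c: relabel by (a c)(b y)
    refine h.transport ![2, 3, 0, 1] (by decide) rfl fun x => Or.inr ?_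
    show connEvent (sep [x 2, x 3] [x 0, x 1]) = connEvent (sep [x 0, x 1] [x 2, x 3]) ∧
      connEvent (sep [x 2] [x 3]) = connEvent (sep [x 2] [x 3]) ∧ connEvent (sep [x 0] [x 1]) = connEvent (sep [x 0] [x 1])
    exact ⟨connEvent_sep_comm _ _, rfl, rfl⟩
  · -- y: relabel by (a y)(b c)
    refine h.transport ![3, 2, 1, 0] (by decide) rfl fun x => Or.inr ?_
    show connEvent (sep [x 3, x 2] [x 1, x 0]) = connEvent (sep [x 0, x 1] [x 2, x 3]) ∧
      connEvent (sep [x 3] [x 2]) = connEvent (sep [x 2] [x 3]) ∧ connEvent (sep [x 1] [x 0]) = connEvent (sep [x 0] [x 1])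
    exact ⟨by rw [connEvent_sep_comm]; exact connEvent_sep_congr (by simp [or_comm]) (by simp [or_comm]),
      connEvent_sep_comm _ _, connEvent_sep_comm _ _⟩

/-- **PATH `(D[a|b], D[a|c], D[b|y])` (row 36): the hypotheses at the hub `a` and at the leaf `c` give them at every terminal** (reflection
`(a b)(c y)` of the path `c – a – b – y`). [this work] -/
theorem unmarkedEdgeHyp_row36_of_at0_at2 {m : ℕ}
    (h0 : UnmarkedEdgeHypAt 0 (fun x : Fin 4 → Fin m => connEvent (FrontierDecRows.row 36 m (x 0, x 1, x 2, x 3)).1)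
      (fun x => connEvent (FrontierDecRows.row 36 m (x 0, x 1, x 2, x 3)).2.1)
      (fun x => connEvent (FrontierDecRows.row 36 m (x 0, x 1, x 2, x 3)).2.2))
    (h2 : UnmarkedEdgeHypAt 2 (fun x : Fin 4 → Fin m => connEvent (FrontierDecRows.row 36 m (x 0, x 1, x 2, x 3)).1)
      (fun x => connEvent (FrontierDecRows.row 36 m (x 0, x 1, x 2, x 3)).2.1)
      (fun x => connEvent (FrontierDecRows.row 36 m (x 0, x 1, x 2, x 3)).2.2)) :
    UnmarkedEdgeHyp (fun x : Fin 4 → Fin m => connEvent (FrontierDecRows.row 36 m (x 0, x 1, x 2, x 3)).1)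
      (fun x => connEvent (FrontierDecRows.row 36 m (x 0, x 1, x 2, x 3)).2.1)
      (fun x => connEvent (FrontierDecRows.row 36 m (x 0, x 1, x 2, x 3)).2.2) := by
  have hE : ∀ x : Fin 4 → Fin m,
      connEvent (sep [(x ∘ ![1, 0, 3, 2]) 0] [(x ∘ ![1, 0, 3, 2]) 1]) = connEvent (sep [x 0] [x 1]) ∧
        connEvent (sep [(x ∘ ![1, 0, 3, 2]) 0] [(x ∘ ![1, 0, 3, 2]) 2]) = connEvent (sep [x 1] [x 3]) ∧
        connEvent (sep [(x ∘ ![1, 0, 3, 2]) 1] [(x ∘ ![1, 0, 3, 2]) 3]) = connEvent (sep [x 0] [x 2]) := by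
    intro x
    show connEvent (sep [x 1] [x 0]) = connEvent (sep [x 0] [x 1]) ∧
      connEvent (sep [x 1] [x 3]) = connEvent (sep [x 1] [x 3]) ∧ connEvent (sep [x 0] [x 2]) = connEvent (sep [x 0] [x 2])
    exact ⟨connEvent_sep_comm _ _, rfl, rfl⟩
  refine unmarkedEdgeHyp_of_forall_at fun i₀ => ?_
  fin_cases i₀
  · exact h0
  · exact h0.transport ![1, 0, 3, 2] (by decide) rfl fun x => Or.inr (hE x)
  · exact h2
  · exact h2.transport ![1, 0, 3, 2] (by decide) rfl fun x => Or.inr (hE x)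

/-- **Row 44 on every finite weighted graph from ONE family of five-point forms**: the unmarked-edge hypotheses at terminal `a` (for every
number of vertices) imply `0 ≤ E₃(D[ab|cy], D[a|b], D[c|y])` for all `n`, `w` and all `a b c y`. [this work] -/
theorem frontier_44_all_of_at0
    (h : ∀ m : ℕ, UnmarkedEdgeHypAt 0 (fun x : Fin 4 → Fin m => connEvent (FrontierDecRows.row 44 m (x 0, x 1, x 2, x 3)).1)
      (fun x => connEvent (FrontierDecRows.row 44 m (x 0, x 1, x 2, x 3)).2.1)
      (fun x => connEvent (FrontierDecRows.row 44 m (x 0, x 1, x 2, x 3)).2.2))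
    (w : Sym2 (Fin n) → unitInterval) (a b c y : Fin n) :
    0 ≤ sahiE3 (prodBernoulli w) (connEvent (FrontierDecRows.row 44 n (a, b, c, y)).1)
      (connEvent (FrontierDecRows.row 44 n (a, b, c, y)).2.1) (connEvent (FrontierDecRows.row 44 n (a, b, c, y)).2.2) :=
  frontier_44_all_of_unmarkedEdgeHyp (fun m => unmarkedEdgeHyp_row44_of_at0 (h m)) w a b c y

/-- **PATH on every finite weighted graph from TWO families of five-point forms**: the unmarked-edge hypotheses at the hub `a` and at the
leaf `c` (for every number of vertices) imply `0 ≤ E₃(D[a|b], D[a|c], D[b|y])` for all `n`, `w` and all `a b c y` — in particular a new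
inductive route to 3PT-LB (`c = y`). [this work] -/
theorem frontier_36_all_of_at0_at2
    (h0 : ∀ m : ℕ, UnmarkedEdgeHypAt 0 (fun x : Fin 4 → Fin m => connEvent (FrontierDecRows.row 36 m (x 0, x 1, x 2, x 3)).1)
      (fun x => connEvent (FrontierDecRows.row 36 m (x 0, x 1, x 2, x 3)).2.1)
      (fun x => connEvent (FrontierDecRows.row 36 m (x 0, x 1, x 2, x 3)).2.2))
    (h2 : ∀ m : ℕ, UnmarkedEdgeHypAt 2 (fun x : Fin 4 → Fin m => connEvent (FrontierDecRows.row 36 m (x 0, x 1, x 2, x 3)).1)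
      (fun x => connEvent (FrontierDecRows.row 36 m (x 0, x 1, x 2, x 3)).2.1)
      (fun x => connEvent (FrontierDecRows.row 36 m (x 0, x 1, x 2, x 3)).2.2))
    (w : Sym2 (Fin n) → unitInterval) (a b c y : Fin n) :
    0 ≤ sahiE3 (prodBernoulli w) (connEvent (FrontierDecRows.row 36 n (a, b, c, y)).1)
      (connEvent (FrontierDecRows.row 36 n (a, b, c, y)).2.1) (connEvent (FrontierDecRows.row 36 n (a, b, c, y)).2.2) :=
  frontier_36_all_of_unmarkedEdgeHyp (fun m => unmarkedEdgeHyp_row36_of_at0_at2 (h0 m) (h2 m)) w a b c y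

end TerminalEdgeInduction

end Summit.CriticalPhenomena.PercolationContinuityZ3.Theorems
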